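import Summits.QuantumFields.YangMills.Theorems.BalabanUVNodesN06AtRecord11Obligations
import Literature.MathematicalPhysics.QuantumFieldTheory.Balaban1983to89.B9Thm311Whole
import Literature.MathematicalPhysics.QuantumFieldTheory.Balaban1983to89.B9Thm310Whole
import Literature.MathematicalPhysics.QuantumFieldTheory.Balaban1983to89.B9Thm315Whole
import Literature.MathematicalPhysics.QuantumFieldTheory.Balaban1983to89.B9Thm314Whole

/-!
# BalabanUVNodes ∕ N06 ([B9], `Dag.B9_main`) — OBLIGATIONS OF THE STAGE-11 CERTIFICATE KNIT AT THE RECORD, XI-a: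
# rows 17 (`t311`), 18 (`t310` + the G-half of `hsum`), 23 (`t314loc`), 24 (`t315`) AS LEMMAS AT THE RECORD, from the suppliers' pins (n06-j, n06-k, n06-m)

Track A of `YM-PLAN.md` (cell `pub-ymgap`, HUMAN RULING D-0062), node **N06** = [Balaban1985BackgroundPropagators] Thms 3.1–3.15; seat
`pub-ymgap-dag-n06-d` gen 2 = dag-lead N06-ASSIGNMENT v1 (P3) «THE KNIT AT THE RECORD».  Companion of the chain files `BalabanUVNodesN06AtRecord11Obligations*`:
this module holds the PER-ROW lemmas (each concludes the certificate binder's type VERBATIM at `ops : OpsY N θ₃ M⋆`), so that the chain links — and the final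
instantiation at def-Y's `Node00.opsYOfLetters` — can mix supplier routes row by row.

ROWS AND SUPPLIERS (consumed BY NAME at `I := MemberY`, `geo9Y`, `bg9Y (M_N ℂ) SU(N)`, `c35Y`; every schema displayed, nothing of [B9] asserted):
* row 17 `t311_of_pin` — n06-j's `B9Thm311Whole.thm311Printed_of_inputs` (p463797) at the LITERAL pin `(ops x).PosDef = PosDefOfOps (𝔬311 x)` (Thm 3.11 p. 416).
* row 18 `t310_of_pin` — n06-k's `B9Thm310Whole.thm310Printed_of_local3107` (p463865) at the LITERAL pin `(ops x).E310 = W310OfOps (𝔬310 x) (rd310 x) (Conv3107 … (const37 …)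
  ((1−2α)δ₀))`; `clause342_GA_of_conv3107` — the (3.42) clauses for `(ops x).GA` from `Conv3107` + four co-readings (mirror of sequel I's `clause342_Gp_of_conv342`);
  `hsumG_of_pin` — the G-half of the summation leaf in the shape sequel I's `rwSumsYieldIneqs_of_conv342_pin` displays it (`h310`), FROM the pin, the co-readings and
  the displayed (3.46)∕(3.47)∕(3.43)–(3.45) residual for `GA` (cell GAPS G-B9-07; INTERFACE-2∕2b).
* row 23 `t314loc_of_leaves` — n06-m's `B9Thm314Whole.thm314LocalPrinted_of_leaves` (p463881) with the signs `modelSignsOn_geo9K` and `dOmegaY ≥ 0` discharged.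
* row 24 `t315_of_pins` — n06-m's `B9Thm315Whole.thm315FullPrinted_of_3185` (p462686) transported to the layer's abstract slots by `thm315FullPrinted_of_imp`.

HONEST FRAMING.  Kernel bookkeeping at pinned readings; 0 `def`, 0 `sorry`, standard axioms; COUNT-NEUTRAL (`--supports` K1 `StabilityBAtRecordR11e`); nothing of [B9] is
proved for Bałaban's operators; N06 is NOT discharged.  One finite four-torus programme at fixed `ε` — NOT ℝ⁴, NOT OS, NOT a mass gap, NOT Clay.  No `def`.
-/

noncomputable section

namespace Summit.QuantumFields.YangMills.BalabanUVNodes.N06AtRecord11ObligationsPins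

open Literature.MathematicalPhysics.QuantumFieldTheory.Balaban1983to89
open Literature.MathematicalPhysics.QuantumFieldTheory.Balaban1983to89.Node00
open Literature.MathematicalPhysics.QuantumFieldTheory.Balaban1983to89.B9PinMembersKLevelV1 (MemberY geo9Y bg9Y)
open Literature.MathematicalPhysics.QuantumFieldTheory.Balaban1983to89.B9PinGeometryKLevelV1 (dOmegaY OmKY inΛY unitDistY c35Y c35Y_pos dOmegaY_nonneg)
open Literature.MathematicalPhysics.QuantumFieldTheory.Balaban1983to89.B7Prop2SpecialUnitary (specialUnitaryUnits)
open Literature.MathematicalPhysics.QuantumFieldTheory.Balaban1983to89.B9Thm37Whole (const37)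
open Literature.MathematicalPhysics.QuantumFieldTheory.Balaban1983to89.B9Thm37GlueCor36
  (CoRealizes Clause342 clause342_all clause342_e0_of_hasMajorant clause342_e1_of_hasMajorantHom clause342_e2_of_hasMajorantHom clause342_e3_of_hasMajorantHom
    ineq342_346_347_of_clauses)
open Literature.MathematicalPhysics.QuantumFieldTheory.Balaban1983to89.B6RandomWalk (Ineq261)
open Literature.MathematicalPhysics.QuantumFieldTheory.Balaban1983to89.B9Thm34Ext (toB6)
open Literature.MathematicalPhysics.QuantumFieldTheory.Balaban1983to89.B9Thm314 (Thm314LocalPrinted)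
open Literature.MathematicalPhysics.QuantumFieldTheory.Balaban1983to89.B6KLevelCensusIndexV1 (len_pos)
open Literature.MathematicalPhysics.QuantumFieldTheory.Balaban1983to89.B9GeoNormsKLevelModelSignsV1 (modelSignsOn_geo9K)
open Literature.MathematicalPhysics.QuantumFieldTheory.Balaban1983to89.B9Thm311Whole (Ops311 PosDefOfOps Inputs311 thm311Printed_of_inputs)
open Literature.MathematicalPhysics.QuantumFieldTheory.Balaban1983to89.B9Thm310Whole
  (Ops310 WalkReading310 Sizes310 StaticOK310 Locality310 Local342G Factors389 Identities310 W310OfOps Conv3107 thm310Printed_of_local3107)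
open Literature.MathematicalPhysics.QuantumFieldTheory.Balaban1983to89.B9Thm315Whole
  (Ops315 Reads315 Static315 GivenBy3185OfOps HasRWExpCOfOps thm315FullPrinted_of_3185 thm315FullPrinted_of_imp)
open Literature.MathematicalPhysics.QuantumFieldTheory.Balaban1983to89.B9Thm314Whole
  (DiffExpansionAllNorms RWSumFactorYieldsSupL2 RWSumFactorYieldsHolder thm314LocalPrinted_of_leaves)
open Summit.QuantumFields.YangMills.BalabanUVNodes.N06AtRecord11Obligations (clause342_Gp_mono_pin const37_nonneg)
open scoped Matrix.Norms.L2Operator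

variable {N : ℕ} (θ₃ : Stage3Params) (Mstar : ℕ) (ops : OpsY N θ₃ Mstar)

/-! ## row 17 — Theorem 3.11 at the literal pin of `PosDef` -/

/-- **ROW 17 `t311` AT THE RECORD FROM n06-j's LEAF**: with the layer's positivity slots PINNED to the letters of Theorem 3.11 (`(ops x).PosDef = PosDefOfOps (𝔬311 x)`), the
printed proof's inputs `Inputs311` under the provisos (M ≧ M₁, 0 < α₀, Mα₀ ≦ a₁, (3.35)) give `B9.Thm311Printed c35Y geo9Y (bg9Y …) (fun x => (ops x).PosDef)` — the
certificate's binder verbatim.  Displayed: letters, inputs, pin. [cite: Balaban1985BackgroundPropagators, Thm 3.11 p.416 + (3.35) p.396] -/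
theorem t311_of_pin {E F W : MemberY θ₃.d₆ θ₃.ℓ₆ θ₃.hd' θ₃.hL' θ₃.b₀ θ₃.b₁ Mstar → Type} [∀ x, NormedAddCommGroup (E x)] [∀ x, InnerProductSpace ℝ (E x)] [∀ x, NormedAddCommGroup (F x)]
    [∀ x, InnerProductSpace ℝ (F x)] [∀ x, NormedAddCommGroup (W x)] [∀ x, InnerProductSpace ℝ (W x)] [∀ x, FiniteDimensional ℝ (W x)]
    (𝔬311 : ∀ x : MemberY θ₃.d₆ θ₃.ℓ₆ θ₃.hd' θ₃.hL' θ₃.b₀ θ₃.b₁ Mstar, Ops311 (bg9Y (Matrix (Fin N) (Fin N) ℂ) (specialUnitaryUnits (Fin N)) x) (E x) (F x) (W x)) (θ₁ a₁ M₁ : ℝ) (ha₁ : 0 < a₁) (hM₁ : 0 < M₁)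
    (h311 : ∀ x : MemberY θ₃.d₆ θ₃.ℓ₆ θ₃.hd' θ₃.hL' θ₃.b₀ θ₃.b₁ Mstar, M₁ ≤ (geo9Y x).M → ∀ α₀ : ℝ, 0 < α₀ → (geo9Y x).M * α₀ ≤ a₁ →
      ∀ U : (bg9Y (Matrix (Fin N) (Fin N) ℂ) (specialUnitaryUnits (Fin N)) x).Cfg, (bg9Y (Matrix (Fin N) (Fin N) ℂ) (specialUnitaryUnits (Fin N)) x).Reg335 c35Y α₀ U → Inputs311 (𝔬311 x) θ₁ (geo9Y x).M U)
    (hPD : ∀ x : MemberY θ₃.d₆ θ₃.ℓ₆ θ₃.hd' θ₃.hL' θ₃.b₀ θ₃.b₁ Mstar, (ops x).PosDef = PosDefOfOps (𝔬311 x)) :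
    B9.Thm311Printed c35Y geo9Y (bg9Y (Matrix (Fin N) (Fin N) ℂ) (specialUnitaryUnits (Fin N))) (fun x => (ops x).PosDef) := by
  have hfun : (fun x => (ops x).PosDef) = fun x => PosDefOfOps (𝔬311 x) := funext hPD
  rw [hfun]
  exact thm311Printed_of_inputs 𝔬311 θ₁ a₁ M₁ ha₁ hM₁ h311

/-! ## row 18 — Theorem 3.10 at the literal pin of `E310`, and the G-half of the summation leaf -/

/-- **ROW 18 `t310` AT THE RECORD FROM n06-k's LEAF** at the LITERAL pin `(ops x).E310 = W310OfOps (𝔬310 x) (rd310 x) (Conv3107 … (const37 …) ((1−2α)δ₀))` (the leaf reads the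
walk data, so an implication on `Converges` is not enough): from the schemas `StaticOK310`, `Sizes310.Bounded`, `WalkReading310.OK`, `Locality310`, (2.61) for M ≧ M_L,
«Cor. 3.6 ⇒ `Local342G ∧ Factors389 ∧ Identities310`» under the provisos — `B9.Thm310Printed c35Y geo9Y (bg9Y …) (fun x => (ops x).E310)`, the certificate's binder
verbatim; `0 < c35` by `c35Y_pos`. [cite: Balaban1985BackgroundPropagators, Thm 3.10 (3.107)–(3.108) pp.414–416, Cor. 3.6 p.408; Balaban1984PropagatorsII, Lemma 2.1 (2.61) p.234] -/
theorem t310_of_pin [∀ x : MemberY θ₃.d₆ θ₃.ℓ₆ θ₃.hd' θ₃.hL' θ₃.b₀ θ₃.b₁ Mstar, Fintype (geo9Y x).Site] [∀ x : MemberY θ₃.d₆ θ₃.ℓ₆ θ₃.hd' θ₃.hL' θ₃.b₀ θ₃.b₁ Mstar, DecidableEq (geo9Y x).Site]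
    {X Y ι A : MemberY θ₃.d₆ θ₃.ℓ₆ θ₃.hd' θ₃.hL' θ₃.b₀ θ₃.b₁ Mstar → Type} [∀ x, Fintype (X x)] [∀ x, DecidableEq (X x)] [∀ x, Fintype (Y x)] [∀ x, DecidableEq (Y x)]
    [∀ x, Fintype (ι x)] [∀ x, Fintype (A x)]
    (𝔬310 : ∀ x : MemberY θ₃.d₆ θ₃.ℓ₆ θ₃.hd' θ₃.hL' θ₃.b₀ θ₃.b₁ Mstar, Ops310 (geo9Y x) (bg9Y (Matrix (Fin N) (Fin N) ℂ) (specialUnitaryUnits (Fin N)) x) (X x) (Y x) (ι x) (A x))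
    (rd310 : ∀ x : MemberY θ₃.d₆ θ₃.ℓ₆ θ₃.hd' θ₃.hL' θ₃.b₀ θ₃.b₁ Mstar, WalkReading310 (geo9Y x) (bg9Y (Matrix (Fin N) (Fin N) ℂ) (specialUnitaryUnits (Fin N)) x) (X x) (ι x) (A x))
    (R : MemberY θ₃.d₆ θ₃.ℓ₆ θ₃.hd' θ₃.hL' θ₃.b₀ θ₃.b₁ Mstar → ℝ) (H : MemberY θ₃.d₆ θ₃.ℓ₆ θ₃.hd' θ₃.hL' θ₃.b₀ θ₃.b₁ Mstar → Prop) (κ : MemberY θ₃.d₆ θ₃.ℓ₆ θ₃.hd' θ₃.hL' θ₃.b₀ θ₃.b₁ Mstar → Sizes310)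
    (d : ℕ) (α ρ Nc N' NF Cℓ K θ₀ B₀ δ₀ a₁ M₁ ML : ℝ)
    (hα : 0 ≤ α) (hα2 : α ≤ 1 / 2) (hN : 0 ≤ Nc) (hN' : 0 ≤ N') (hNF : 0 ≤ NF) (hCℓ : 1 ≤ Cℓ) (hK : 0 ≤ K) (hθ₀ : 0 ≤ θ₀) (hB₀ : 0 < B₀)
    (hδ₀ : 0 < δ₀) (ha₁ : 0 < a₁) (hM₁ : 0 < M₁)
    (hst : ∀ x, StaticOK310 (𝔬310 x) ρ Nc N' NF Cℓ (κ x)) (hκ : ∀ x, (κ x).Bounded K)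
    (hrd : ∀ x, (rd310 x).OK (𝔬310 x).blk) (hloc : ∀ x, Locality310 (𝔬310 x) (rd310 x))
    (h261 : ∀ x : MemberY θ₃.d₆ θ₃.ℓ₆ θ₃.hd' θ₃.hL' θ₃.b₀ θ₃.b₁ Mstar, ML ≤ (geo9Y x).M → Ineq261 d (toB6 (geo9Y x) (R x) (H x)) δ₀ α)
    (h36 : ∀ x : MemberY θ₃.d₆ θ₃.ℓ₆ θ₃.hd' θ₃.hL' θ₃.b₀ θ₃.b₁ Mstar, M₁ ≤ (geo9Y x).M → ∀ α₀ : ℝ, 0 < α₀ → c35Y * (geo9Y x).M * α₀ ≤ a₁ →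
      ∀ U : (bg9Y (Matrix (Fin N) (Fin N) ℂ) (specialUnitaryUnits (Fin N)) x).Cfg, (bg9Y (Matrix (Fin N) (Fin N) ℂ) (specialUnitaryUnits (Fin N)) x).Reg335 c35Y α₀ U →
        Local342G (𝔬310 x) (R x) (H x) B₀ δ₀ U ∧ Factors389 (𝔬310 x) (R x) (H x) θ₀ δ₀ U ∧ Identities310 (𝔬310 x) (R x) (H x) U)
    (hE310 : ∀ x : MemberY θ₃.d₆ θ₃.ℓ₆ θ₃.hd' θ₃.hL' θ₃.b₀ θ₃.b₁ Mstar, (ops x).E310 = W310OfOps (𝔬310 x) (rd310 x)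
      (Conv3107 (𝔬310 x) (R x) (H x) (const37 d δ₀ α ρ B₀ Nc N' Cℓ K) ((1 - 2 * α) * δ₀))) :
    B9.Thm310Printed c35Y geo9Y (bg9Y (Matrix (Fin N) (Fin N) ℂ) (specialUnitaryUnits (Fin N))) (fun x => (ops x).E310) := by
  have hfun : (fun x => (ops x).E310) = fun x => W310OfOps (𝔬310 x) (rd310 x)
      (Conv3107 (𝔬310 x) (R x) (H x) (const37 d δ₀ α ρ B₀ Nc N' Cℓ K) ((1 - 2 * α) * δ₀)) := funext hE310
  rw [hfun]
  exact thm310Printed_of_local3107 𝔬310 rd310 R H κ d α ρ Nc N' NF Cℓ K θ₀ B₀ δ₀ a₁ M₁ ML c35Y_pos hα hα2 hN hN' hNF hCℓ hK hθ₀ hB₀ hδ₀ ha₁ hM₁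
    hst hκ hrd hloc h261 h36

/-- **The four (3.42) clauses for `(ops x).GA` at constants `(C, δ)` from the pinned convergence reading of Theorem 3.10's expansion** — `Conv3107 (𝔬310 x) (R x) (H x) C δ U`
(the four majorants of G(U), ∇_UG(U), G(U)∇*_U, Δ_UG(U) over `toB6`) — and the four CO-READINGS of `(ops x).GA`'s observation quantities by those letters (n06-c's
`CoRealizes`; the device of n06-k's `clause342_of_thm310Printed`, here per `U` without the provisos).  `Lʲη ≥ 0` by `len_pos`.
[cite: Balaban1985BackgroundPropagators, Thm 3.10 ⇒ Thm 3.3 p.416 + (3.42) p.397] -/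
theorem clause342_GA_of_conv3107 [∀ x : MemberY θ₃.d₆ θ₃.ℓ₆ θ₃.hd' θ₃.hL' θ₃.b₀ θ₃.b₁ Mstar, Fintype (geo9Y x).Site] [∀ x : MemberY θ₃.d₆ θ₃.ℓ₆ θ₃.hd' θ₃.hL' θ₃.b₀ θ₃.b₁ Mstar, DecidableEq (geo9Y x).Site]
    {X Y ι A : MemberY θ₃.d₆ θ₃.ℓ₆ θ₃.hd' θ₃.hL' θ₃.b₀ θ₃.b₁ Mstar → Type}
    (𝔬 : ∀ x, Ops310 (geo9Y x) (bg9Y (Matrix (Fin N) (Fin N) ℂ) (specialUnitaryUnits (Fin N)) x) (X x) (Y x) (ι x) (A x))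
    (R : MemberY θ₃.d₆ θ₃.ℓ₆ θ₃.hd' θ₃.hL' θ₃.b₀ θ₃.b₁ Mstar → ℝ) (H : MemberY θ₃.d₆ θ₃.ℓ₆ θ₃.hd' θ₃.hL' θ₃.b₀ θ₃.b₁ Mstar → Prop) {C δ : ℝ} (hC : 0 ≤ C)
    (ev : ∀ x : MemberY θ₃.d₆ θ₃.ℓ₆ θ₃.hd' θ₃.hL' θ₃.b₀ θ₃.b₁ Mstar, (geo9Y x).Loc → X x → ℝ) (evY : ∀ x : MemberY θ₃.d₆ θ₃.ℓ₆ θ₃.hd' θ₃.hL' θ₃.b₀ θ₃.b₁ Mstar, (geo9Y x).Loc → Y x → ℝ)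
    (hco0 : ∀ x U, CoRealizes (ops x).GA 0 U (𝔬 x).blk (𝔬 x).blk (ev x) ((𝔬 x).G U))
    (hco1 : ∀ x U, CoRealizes (ops x).GA 1 U (𝔬 x).blkY (𝔬 x).blk (ev x) ((𝔬 x).D U ∘ₗ (𝔬 x).G U))
    (hco2 : ∀ x U, CoRealizes (ops x).GA 2 U (𝔬 x).blk (𝔬 x).blkY (evY x) ((𝔬 x).G U ∘ₗ (𝔬 x).Dstar U))
    (hco3 : ∀ x U, CoRealizes (ops x).GA 3 U (𝔬 x).blk (𝔬 x).blk (ev x) ((𝔬 x).Lap U ∘ₗ (𝔬 x).G U))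
    (x : MemberY θ₃.d₆ θ₃.ℓ₆ θ₃.hd' θ₃.hL' θ₃.b₀ θ₃.b₁ Mstar) (U : (bg9Y (Matrix (Fin N) (Fin N) ℂ) (specialUnitaryUnits (Fin N)) x).Cfg) (hconv : Conv3107 (𝔬 x) (R x) (H x) C δ U) (n : Fin 4) : Clause342 (ops x).GA n C δ U := by
  have hlen : ∀ y : (geo9Y x).Site, 0 ≤ (geo9Y x).len y := fun y => (len_pos x.toKIdx y).le
  obtain ⟨h0, h1, h2, h3⟩ := hconv
  exact clause342_all (clause342_e0_of_hasMajorant (hco0 x U) h0 hC hlen) (clause342_e1_of_hasMajorantHom (hco1 x U) h1 hC hlen)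
    (clause342_e2_of_hasMajorantHom (hco2 x U) h2 hC hlen) (clause342_e3_of_hasMajorantHom (hco3 x U) h3 hC hlen) n

/-- **THE G-HALF OF THE SUMMATION LEAF `hsum` AT THE `W310OfOps` PIN** in the shape sequel I's `rwSumsYieldIneqs_of_conv342_pin` displays it (`h310`: convergence of
`(ops x).E310` at `U` ⇒ (3.42)–(3.47) for `(ops x).GA` with the summation constants `(B₁, δ₁, B(·), B′(·), B′(·,·))`): the (3.42) block is PROVED from the pin and the
co-readings (`clause342_GA_of_conv3107` + monotonicity `const37 … ≤ B₁`, `δ₁ ≤ (1−2α)δ₀`); the (3.46)∕(3.47)∕(3.43)–(3.45) blocks are DISPLAYED (`hrestA`) — under the pin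
they are not consequences of convergence (cell GAPS G-B9-07; INTERFACE-2∕2b). [cite: Balaban1985BackgroundPropagators, Thm 3.10 ⇒ Thm 3.3 p.416, (3.42)–(3.47) pp.397–398] -/
theorem hsumG_of_pin [∀ x : MemberY θ₃.d₆ θ₃.ℓ₆ θ₃.hd' θ₃.hL' θ₃.b₀ θ₃.b₁ Mstar, Fintype (geo9Y x).Site] [∀ x : MemberY θ₃.d₆ θ₃.ℓ₆ θ₃.hd' θ₃.hL' θ₃.b₀ θ₃.b₁ Mstar, DecidableEq (geo9Y x).Site]
    {X Y ι A : MemberY θ₃.d₆ θ₃.ℓ₆ θ₃.hd' θ₃.hL' θ₃.b₀ θ₃.b₁ Mstar → Type}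
    (𝔬310 : ∀ x, Ops310 (geo9Y x) (bg9Y (Matrix (Fin N) (Fin N) ℂ) (specialUnitaryUnits (Fin N)) x) (X x) (Y x) (ι x) (A x))
    (rd310 : ∀ x : MemberY θ₃.d₆ θ₃.ℓ₆ θ₃.hd' θ₃.hL' θ₃.b₀ θ₃.b₁ Mstar, WalkReading310 (geo9Y x) (bg9Y (Matrix (Fin N) (Fin N) ℂ) (specialUnitaryUnits (Fin N)) x) (X x) (ι x) (A x))
    (R : MemberY θ₃.d₆ θ₃.ℓ₆ θ₃.hd' θ₃.hL' θ₃.b₀ θ₃.b₁ Mstar → ℝ) (H : MemberY θ₃.d₆ θ₃.ℓ₆ θ₃.hd' θ₃.hL' θ₃.b₀ θ₃.b₁ Mstar → Prop) (d : ℕ) {α ρ Nc N' Cℓ K B₀ δ₀ : ℝ}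
    (hN : 0 ≤ Nc) (hN' : 0 ≤ N') (hCℓ : 1 ≤ Cℓ) (hK : 0 ≤ K) (hB₀ : 0 < B₀)
    (hE310 : ∀ x : MemberY θ₃.d₆ θ₃.ℓ₆ θ₃.hd' θ₃.hL' θ₃.b₀ θ₃.b₁ Mstar, (ops x).E310 = W310OfOps (𝔬310 x) (rd310 x)
      (Conv3107 (𝔬310 x) (R x) (H x) (const37 d δ₀ α ρ B₀ Nc N' Cℓ K) ((1 - 2 * α) * δ₀)))
    (ev : ∀ x : MemberY θ₃.d₆ θ₃.ℓ₆ θ₃.hd' θ₃.hL' θ₃.b₀ θ₃.b₁ Mstar, (geo9Y x).Loc → X x → ℝ) (evY : ∀ x : MemberY θ₃.d₆ θ₃.ℓ₆ θ₃.hd' θ₃.hL' θ₃.b₀ θ₃.b₁ Mstar, (geo9Y x).Loc → Y x → ℝ)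
    (hco0 : ∀ x U, CoRealizes (ops x).GA 0 U (𝔬310 x).blk (𝔬310 x).blk (ev x) ((𝔬310 x).G U))
    (hco1 : ∀ x U, CoRealizes (ops x).GA 1 U (𝔬310 x).blkY (𝔬310 x).blk (ev x) ((𝔬310 x).D U ∘ₗ (𝔬310 x).G U))
    (hco2 : ∀ x U, CoRealizes (ops x).GA 2 U (𝔬310 x).blk (𝔬310 x).blkY (evY x) ((𝔬310 x).G U ∘ₗ (𝔬310 x).Dstar U))
    (hco3 : ∀ x U, CoRealizes (ops x).GA 3 U (𝔬310 x).blk (𝔬310 x).blk (ev x) ((𝔬310 x).Lap U ∘ₗ (𝔬310 x).G U))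
    {B₁ δ₁ : ℝ} (hCB : const37 d δ₀ α ρ B₀ Nc N' Cℓ K ≤ B₁) (hδ₁le : δ₁ ≤ (1 - 2 * α) * δ₀) {Bβ Bε : ℝ → ℝ} {Bεβ : ℝ → ℝ → ℝ}
    (hrestA : ∀ (x : MemberY θ₃.d₆ θ₃.ℓ₆ θ₃.hd' θ₃.hL' θ₃.b₀ θ₃.b₁ Mstar) (U : (bg9Y (Matrix (Fin N) (Fin N) ℂ) (specialUnitaryUnits (Fin N)) x).Cfg),
      ((ops x).E310).Converges U →
        (∀ (n : Fin 6) (lam : (geo9Y x).Loc) (h : (geo9Y x).Cut) (y y' : (geo9Y x).Site), (geo9Y x).cutIn h y → (geo9Y x).suppIn lam y' →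
            (ops x).GA.l2 n U lam h ≤ B₁ * B9.pref6 ((geo9Y x).len y) n * (geo9Y x).cutSup h * Real.exp (-(δ₁ * (geo9Y x).dist y y')) * (geo9Y x).l2Norm lam) ∧
        (∀ (n : Fin 4) (lam : (geo9Y x).Loc) (γ : ℝ), -4 ≤ γ → γ ≤ 4 → (ops x).GA.glob n U lam γ ≤ B₁ * (geo9Y x).wNorm γ lam) ∧
        B9.Ineq343_345 (ops x).GA Bβ Bε Bεβ δ₁ U)
    (x : MemberY θ₃.d₆ θ₃.ℓ₆ θ₃.hd' θ₃.hL' θ₃.b₀ θ₃.b₁ Mstar) (U : (bg9Y (Matrix (Fin N) (Fin N) ℂ) (specialUnitaryUnits (Fin N)) x).Cfg) (hconv : ((ops x).E310).Converges U) :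
    B9.Ineq342_346_347 (ops x).GA B₁ δ₁ U ∧ B9.Ineq343_345 (ops x).GA Bβ Bε Bεβ δ₁ U := by
  have hC : 0 ≤ const37 d δ₀ α ρ B₀ Nc N' Cℓ K := const37_nonneg d hB₀.le hN hN' hCℓ hK
  obtain ⟨h346, h347, hH⟩ := hrestA x U hconv
  have hconv' : Conv3107 (𝔬310 x) (R x) (H x) (const37 d δ₀ α ρ B₀ Nc N' Cℓ K) ((1 - 2 * α) * δ₀) U := by
    rw [hE310 x] at hconv; exact hconv
  refine ⟨ineq342_346_347_of_clauses (fun n => ?_) h346 h347, hH⟩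
  exact clause342_Gp_mono_pin θ₃ Mstar x (clause342_GA_of_conv3107 θ₃ Mstar ops 𝔬310 R H hC ev evY hco0 hco1 hco2 hco3 x U hconv' n) hC hCB hδ₁le

/-! ## row 23 — Theorem 3.14 (local reading) from the leaves of the printed proof -/

/-- **ROW 23 `t314loc` AT THE RECORD FROM n06-m's LEAF**: the all-norms cancellation leaf, the geometry of (3.93)∕(3.154) against `dOmegaY`, the two summation-with-factor leaves
on `OmKY`, under the M-uniform diameter bound (flag T314 (ii) travels with it) — `Thm314LocalPrinted c35Y geo9Y (bg9Y …) (fun x => (ops x).Kdiff) OmKY dOmegaY`, the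
certificate's binder verbatim; signs by `modelSignsOn_geo9K`, `dOmegaY ≥ 0` by `dOmegaY_nonneg`. [cite: Balaban1985BackgroundPropagators, Thm 3.14 (3.154) pp.426–427] -/
theorem t314loc_of_leaves {Ediff : ∀ x : MemberY θ₃.d₆ θ₃.ℓ₆ θ₃.hd' θ₃.hL' θ₃.b₀ θ₃.b₁ Mstar, B9.RWExpansion (geo9Y x) (bg9Y (Matrix (Fin N) (Fin N) ℂ) (specialUnitaryUnits (Fin N)) x)}
    {termK : ∀ x : MemberY θ₃.d₆ θ₃.ℓ₆ θ₃.hd' θ₃.hL' θ₃.b₀ θ₃.b₁ Mstar, (Ediff x).Walk → B9.KernelFamily (geo9Y x) (bg9Y (Matrix (Fin N) (Fin N) ℂ) (specialUnitaryUnits (Fin N)) x)}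
    (D : ∀ x : MemberY θ₃.d₆ θ₃.ℓ₆ θ₃.hd' θ₃.hL' θ₃.b₀ θ₃.b₁ Mstar, B9Thm314.LocData (geo9Y x) (bg9Y (Matrix (Fin N) (Fin N) ℂ) (specialUnitaryUnits (Fin N)) x) (Ediff x)) (L : ∀ x, (D x).Laws (dOmegaY x)) (r₀ : ℝ) (hr : ∀ x, (D x).diam ≤ r₀)
    (hA : DiffExpansionAllNorms c35Y geo9Y (bg9Y (Matrix (Fin N) (Fin N) ℂ) (specialUnitaryUnits (Fin N))) Ediff termK (fun x => (D x).Touches))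
    (hS : RWSumFactorYieldsSupL2 geo9Y (bg9Y (Matrix (Fin N) (Fin N) ℂ) (specialUnitaryUnits (Fin N))) Ediff termK (fun x => (ops x).Kdiff) OmKY)
    (hH : RWSumFactorYieldsHolder geo9Y (bg9Y (Matrix (Fin N) (Fin N) ℂ) (specialUnitaryUnits (Fin N))) Ediff termK (fun x => (ops x).Kdiff) OmKY) :
    Thm314LocalPrinted c35Y geo9Y (bg9Y (Matrix (Fin N) (Fin N) ℂ) (specialUnitaryUnits (Fin N))) (fun x => (ops x).Kdiff) OmKY dOmegaY :=
  thm314LocalPrinted_of_leaves D L r₀ hr (fun x => modelSignsOn_geo9K x.toKIdx) (fun x y y' => dOmegaY_nonneg x y y') hA hS hH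

/-! ## row 24 — Theorem 3.15 (full) at the pins, transported to the layer's slots -/

/-- **ROW 24 `t315` AT THE RECORD FROM n06-m's LEAF**: the letters `Ops315`, the reading `Reads315` of `(ops x).Ck` on `inΛY`, the locality `Static315` against `unitDistY`, the
two pinned clauses ((3.185), the summed RW bound at rate δ₁) under the printed prefix, and the slot implications `GivenBy3185OfOps ⇒ (ops x).GivenBy3185`,
`HasRWExpCOfOps ⇒ (ops x).HasRWExpC` — `B9.Thm315FullPrinted c35Y geo9Y (bg9Y …) (fun x => (ops x).Ck) inΛY unitDistY (fun x => (ops x).GivenBy3185) (fun x => (ops x).HasRWExpC)`,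
the certificate's binder verbatim. [cite: Balaban1985BackgroundPropagators, Thm 3.15 (3.185)–(3.187) p.432] -/
theorem t315_of_pins {𝔸 : Type} [NormedRing 𝔸] {P W : MemberY θ₃.d₆ θ₃.ℓ₆ θ₃.hd' θ₃.hL' θ₃.b₀ θ₃.b₁ Mstar → Type} [∀ x, Fintype (P x)]
    (𝔬315 : ∀ x : MemberY θ₃.d₆ θ₃.ℓ₆ θ₃.hd' θ₃.hL' θ₃.b₀ θ₃.b₁ Mstar, Ops315 (geo9Y x) (bg9Y (Matrix (Fin N) (Fin N) ℂ) (specialUnitaryUnits (Fin N)) x) 𝔸 (P x) (W x)) {K r m a₀ δ₁ B₁ : ℝ}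
    (hK : 0 < K) (hm : 0 < m) (ha₀ : 0 < a₀) (hδ₁ : 0 < δ₁) (hB₁ : 0 < B₁)
    (hR : ∀ x : MemberY θ₃.d₆ θ₃.ℓ₆ θ₃.hd' θ₃.hL' θ₃.b₀ θ₃.b₁ Mstar, Reads315 (𝔬315 x) (ops x).Ck (inΛY x) K) (hS : ∀ x : MemberY θ₃.d₆ θ₃.ℓ₆ θ₃.hd' θ₃.hL' θ₃.b₀ θ₃.b₁ Mstar, Static315 (𝔬315 x) (unitDistY x) r m)
    (h : ∀ (x : MemberY θ₃.d₆ θ₃.ℓ₆ θ₃.hd' θ₃.hL' θ₃.b₀ θ₃.b₁ Mstar) (α₀ : ℝ), 0 < α₀ → (geo9Y x).M * α₀ ≤ a₀ →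
      ∀ U : (bg9Y (Matrix (Fin N) (Fin N) ℂ) (specialUnitaryUnits (Fin N)) x).Cfg, (bg9Y (Matrix (Fin N) (Fin N) ℂ) (specialUnitaryUnits (Fin N)) x).Reg335 c35Y α₀ U → (bg9Y (Matrix (Fin N) (Fin N) ℂ) (specialUnitaryUnits (Fin N)) x).Reg336 c35Y α₀ U →
        GivenBy3185OfOps (𝔬315 x) U ∧ HasRWExpCOfOps (𝔬315 x) (unitDistY x) B₁ U δ₁)
    (hG : ∀ (x : MemberY θ₃.d₆ θ₃.ℓ₆ θ₃.hd' θ₃.hL' θ₃.b₀ θ₃.b₁ Mstar) (U : (bg9Y (Matrix (Fin N) (Fin N) ℂ) (specialUnitaryUnits (Fin N)) x).Cfg), GivenBy3185OfOps (𝔬315 x) U → (ops x).GivenBy3185 U)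
    (hHas : ∀ (x : MemberY θ₃.d₆ θ₃.ℓ₆ θ₃.hd' θ₃.hL' θ₃.b₀ θ₃.b₁ Mstar) (U : (bg9Y (Matrix (Fin N) (Fin N) ℂ) (specialUnitaryUnits (Fin N)) x).Cfg) (δ' : ℝ), HasRWExpCOfOps (𝔬315 x) (unitDistY x) B₁ U δ' → (ops x).HasRWExpC U δ') :
    B9.Thm315FullPrinted c35Y geo9Y (bg9Y (Matrix (Fin N) (Fin N) ℂ) (specialUnitaryUnits (Fin N))) (fun x => (ops x).Ck) inΛY unitDistY (fun x => (ops x).GivenBy3185)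
      (fun x => (ops x).HasRWExpC) :=
  thm315FullPrinted_of_imp hG hHas (thm315FullPrinted_of_3185 𝔬315 hK hm ha₀ hδ₁ hB₁ hR hS h)

end Summit.QuantumFields.YangMills.BalabanUVNodes.N06AtRecord11ObligationsPins

end
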